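import Summits.Ventures.PercRepro.C025ProfileThinTriangleC
import Summits.Ventures.PercRepro.C025ProfileCascadeArith

/-!
# THE ROW `(q, q+1)` ON THIN MATROIDS WITH A 3-CIRCUIT — part D: THE THEOREM (night-3 g15)
`proofs/NIGHT3-G14-SIZE.md` §5e; parts A (structure), B ((Dem)), C ((Cap)). `profileIneq_thinTriangle_of_weights`: the row `(q, q+1)`
and its Hall form for ANY weights `s_I, s_Q, g_I, g_J, σ` (with `z_J = 2/3`, `z_F = 1`, `a = 1`) satisfying the hybrid arithmetic —
(Dem) `f (s_I + s_Q) ≥ f + 1`, `2 g_I + (f − 1) g_J ≥ f + 1`, `f σ ≥ 4/3`, `g_I, g_J ≤ 4/3` (`f = |E| − q − 1 ≥ q`); (Cap)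
`2/3 + q g_J ≤ q + 1`, `2 g_I + (q − 1) s_I ≤ q + 1`, `(q − 1) + 3 (q − 1) s_Q ≤ q + 1`, `2 q σ ≤ 8/3`. The weight is an explicit sum
of eight indicator terms on the cardinalities `|B|, |B ∩ K|, |S|, |S ∩ K|` and the inner-point condition `∃ y ∈ S ∖ B, ρ(B ∪ {y}) = q`.
**THEOREM** `profileIneq_thinTriangle` / `hallIneq_thinTriangle`: for every `q ≥ 4` and every finite simple matroid with a 3-circuit in
which every rank-`q` set has at most `q + 1` points, the row `(q, q+1)` of C-032 and its Hall form (C-033) hold — for EVERY `n`: the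
cascade weights of `C025ProfileCascadeArith` with `σ = 4/(3f)` when `f ≥ q`, the zero certificate when `f < q` (nothing is demanding).
`profileIneq_thinTriangle_indep`: the same with the hypotheses in Mathlib's `M.Indep` terms.
-/
open scoped Matroid
namespace PercRepro
open Set Finset ThmH Staged
namespace ThinTriangle
variable {α : Type} [DecidableEq α] {M : Matroid α} [M.Finite]

/-- **THE ROW `(q, q+1)` AND ITS HALL FORM FOR ANY WEIGHTS** satisfying the hybrid (Dem) / (Cap) arithmetic. -/
theorem profileIneq_thinTriangle_of_weights (q : ℕ) (hq4 : 4 ≤ q)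
    (hsimple : ∀ X ⊆ gr M, X.card ≤ 2 → rkN M X = X.card)
    (hthin : ∀ X ⊆ gr M, rkN M X = q → X.card ≤ q + 1)
    (K : Finset α) (hKg : K ⊆ gr M) (hK3 : K.card = 3) (hKrk : rkN M K = 2)
    (sI sQ gI gJ σ : ℚ) (hsI : 0 ≤ sI) (hsQ : 0 ≤ sQ) (hgI : 0 ≤ gI) (hgJ : 0 ≤ gJ) (hσ : 0 ≤ σ)
    (hgI43 : gI ≤ 4 / 3) (hgJ43 : gJ ≤ 4 / 3) (hfq : q ≤ (gr M).card - q - 1)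
    (hdem2 : (((gr M).card - q - 1 : ℕ) : ℚ) + 1 ≤ (((gr M).card - q - 1 : ℕ) : ℚ) * (sI + sQ))
    (hdemG : (((gr M).card - q - 1 : ℕ) : ℚ) + 1 ≤ 2 * gI + (((gr M).card - q - 2 : ℕ) : ℚ) * gJ)
    (hσf : 4 / 3 ≤ (((gr M).card - q - 1 : ℕ) : ℚ) * σ)
    (hcapJ : 2 / 3 + (q : ℚ) * gJ ≤ q + 1) (hcapI : 2 * gI + ((q : ℚ) - 1) * sI ≤ q + 1)
    (hcapQ : ((q : ℚ) - 1) + 3 * ((q : ℚ) - 1) * sQ ≤ q + 1) (h2q : 2 * (q : ℚ) * σ ≤ 8 / 3) :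
    Profile.ProfileIneq M q (q + 1) ∧ Profile.HallIneq M q (q + 1) := by
  let w : Finset α → Finset α → ℚ := fun B S =>
    (if B.card = q + 1 ∧ S.card = q + 2 then (1 : ℚ) else 0) +
    (if B.card = q ∧ (B ∩ K).card = 2 ∧ S.card = q + 1 then sI else 0) +
    (if B.card = q ∧ (B ∩ K).card = 2 ∧ S.card = q + 2 ∧ (S ∩ K).card = 3 then sQ else 0) +
    (if B.card = q ∧ (B ∩ K).card = 1 ∧ S.card = q + 1 ∧ (S ∩ K).card = 2 then gI else 0) +
    (if B.card = q ∧ (B ∩ K).card = 1 ∧ S.card = q + 1 ∧ (S ∩ K).card = 1 then gJ else 0) +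
    (if B.card = q ∧ (B ∩ K).card = 0 ∧ S.card = q + 1 ∧ (S ∩ K).card = 1 then (2 : ℚ) / 3 else 0) +
    (if B.card = q ∧ (B ∩ K).card = 0 ∧ S.card = q + 1 ∧ (S ∩ K).card = 0 then (1 : ℚ) else 0) +
    (if B.card = q ∧ (B ∩ K).card ≤ 1 ∧ S.card = q + 2 ∧ (∃ y ∈ S \ B, rkN M (insert y B) = q) then σ else 0)
  have hw_nonneg : ∀ B S, 0 ≤ w B S := by
    intro B S
    simp only [w]
    repeat' apply add_nonneg
    all_goals split_ifs <;> first | assumption | norm_num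
  -- evaluations of the weight on the types
  have hw_a : ∀ B S : Finset α, B.card = q + 1 → S.card = q + 2 → w B S = 1 := by
    intro B S h1 h2
    simp only [w, if_pos (And.intro h1 h2),
      if_neg (show ¬(B.card = q ∧ (B ∩ K).card = 2 ∧ S.card = q + 1) by omega),
      if_neg (show ¬(B.card = q ∧ (B ∩ K).card = 2 ∧ S.card = q + 2 ∧ (S ∩ K).card = 3) by omega),
      if_neg (show ¬(B.card = q ∧ (B ∩ K).card = 1 ∧ S.card = q + 1 ∧ (S ∩ K).card = 2) by omega),
      if_neg (show ¬(B.card = q ∧ (B ∩ K).card = 1 ∧ S.card = q + 1 ∧ (S ∩ K).card = 1) by omega),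
      if_neg (show ¬(B.card = q ∧ (B ∩ K).card = 0 ∧ S.card = q + 1 ∧ (S ∩ K).card = 1) by omega),
      if_neg (show ¬(B.card = q ∧ (B ∩ K).card = 0 ∧ S.card = q + 1 ∧ (S ∩ K).card = 0) by omega),
      if_neg (show ¬(B.card = q ∧ (B ∩ K).card ≤ 1 ∧ S.card = q + 2 ∧ (∃ y ∈ S \ B, rkN M (insert y B) = q)) from
        fun h => by obtain ⟨h', -, -, -⟩ := h; omega),
      add_zero]
  have hw_a1 : ∀ B S : Finset α, B.card = q + 1 → S.card = q + 2 → w B S ≤ 1 :=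
    fun B S h1 h2 => le_of_eq (hw_a B S h1 h2)
  have hw_2I : ∀ B S : Finset α, B.card = q → (B ∩ K).card = 2 → S.card = q + 1 → w B S = sI := by
    intro B S h1 h2 h3
    simp only [w, if_neg (show ¬(B.card = q + 1 ∧ S.card = q + 2) by omega), if_pos (And.intro h1 (And.intro h2 h3)),
      if_neg (show ¬(B.card = q ∧ (B ∩ K).card = 2 ∧ S.card = q + 2 ∧ (S ∩ K).card = 3) by omega),
      if_neg (show ¬(B.card = q ∧ (B ∩ K).card = 1 ∧ S.card = q + 1 ∧ (S ∩ K).card = 2) by omega),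
      if_neg (show ¬(B.card = q ∧ (B ∩ K).card = 1 ∧ S.card = q + 1 ∧ (S ∩ K).card = 1) by omega),
      if_neg (show ¬(B.card = q ∧ (B ∩ K).card = 0 ∧ S.card = q + 1 ∧ (S ∩ K).card = 1) by omega),
      if_neg (show ¬(B.card = q ∧ (B ∩ K).card = 0 ∧ S.card = q + 1 ∧ (S ∩ K).card = 0) by omega),
      if_neg (show ¬(B.card = q ∧ (B ∩ K).card ≤ 1 ∧ S.card = q + 2 ∧ (∃ y ∈ S \ B, rkN M (insert y B) = q)) from
        fun h => by obtain ⟨-, -, h', -⟩ := h; omega),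
      add_zero, zero_add]
  have hw_2Q : ∀ B S : Finset α, B.card = q → (B ∩ K).card = 2 → S.card = q + 2 → (S ∩ K).card = 3 → w B S = sQ := by
    intro B S h1 h2 h3 h4
    simp only [w, if_neg (show ¬(B.card = q + 1 ∧ S.card = q + 2) by omega),
      if_neg (show ¬(B.card = q ∧ (B ∩ K).card = 2 ∧ S.card = q + 1) by omega),
      if_pos (And.intro h1 (And.intro h2 (And.intro h3 h4))),
      if_neg (show ¬(B.card = q ∧ (B ∩ K).card = 1 ∧ S.card = q + 1 ∧ (S ∩ K).card = 2) by omega),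
      if_neg (show ¬(B.card = q ∧ (B ∩ K).card = 1 ∧ S.card = q + 1 ∧ (S ∩ K).card = 1) by omega),
      if_neg (show ¬(B.card = q ∧ (B ∩ K).card = 0 ∧ S.card = q + 1 ∧ (S ∩ K).card = 1) by omega),
      if_neg (show ¬(B.card = q ∧ (B ∩ K).card = 0 ∧ S.card = q + 1 ∧ (S ∩ K).card = 0) by omega),
      if_neg (show ¬(B.card = q ∧ (B ∩ K).card ≤ 1 ∧ S.card = q + 2 ∧ (∃ y ∈ S \ B, rkN M (insert y B) = q)) from
        fun h => by obtain ⟨-, h', -, -⟩ := h; omega),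
      add_zero, zero_add]
  have hw_2Q0 : ∀ B S : Finset α, B.card = q → (B ∩ K).card = 2 → S.card = q + 2 → (S ∩ K).card ≠ 3 → w B S = 0 := by
    intro B S h1 h2 h3 h4
    simp only [w, if_neg (show ¬(B.card = q + 1 ∧ S.card = q + 2) by omega),
      if_neg (show ¬(B.card = q ∧ (B ∩ K).card = 2 ∧ S.card = q + 1) by omega),
      if_neg (show ¬(B.card = q ∧ (B ∩ K).card = 2 ∧ S.card = q + 2 ∧ (S ∩ K).card = 3) by omega),
      if_neg (show ¬(B.card = q ∧ (B ∩ K).card = 1 ∧ S.card = q + 1 ∧ (S ∩ K).card = 2) by omega),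
      if_neg (show ¬(B.card = q ∧ (B ∩ K).card = 1 ∧ S.card = q + 1 ∧ (S ∩ K).card = 1) by omega),
      if_neg (show ¬(B.card = q ∧ (B ∩ K).card = 0 ∧ S.card = q + 1 ∧ (S ∩ K).card = 1) by omega),
      if_neg (show ¬(B.card = q ∧ (B ∩ K).card = 0 ∧ S.card = q + 1 ∧ (S ∩ K).card = 0) by omega),
      if_neg (show ¬(B.card = q ∧ (B ∩ K).card ≤ 1 ∧ S.card = q + 2 ∧ (∃ y ∈ S \ B, rkN M (insert y B) = q)) from
        fun h => by obtain ⟨-, h', -, -⟩ := h; omega),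
      add_zero]
  have hw_GI : ∀ B S : Finset α, B.card = q → (B ∩ K).card = 1 → S.card = q + 1 → (S ∩ K).card = 2 → w B S = gI := by
    intro B S h1 h2 h3 h4
    simp only [w, if_neg (show ¬(B.card = q + 1 ∧ S.card = q + 2) by omega),
      if_neg (show ¬(B.card = q ∧ (B ∩ K).card = 2 ∧ S.card = q + 1) by omega),
      if_neg (show ¬(B.card = q ∧ (B ∩ K).card = 2 ∧ S.card = q + 2 ∧ (S ∩ K).card = 3) by omega),
      if_pos (And.intro h1 (And.intro h2 (And.intro h3 h4))),
      if_neg (show ¬(B.card = q ∧ (B ∩ K).card = 1 ∧ S.card = q + 1 ∧ (S ∩ K).card = 1) by omega),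
      if_neg (show ¬(B.card = q ∧ (B ∩ K).card = 0 ∧ S.card = q + 1 ∧ (S ∩ K).card = 1) by omega),
      if_neg (show ¬(B.card = q ∧ (B ∩ K).card = 0 ∧ S.card = q + 1 ∧ (S ∩ K).card = 0) by omega),
      if_neg (show ¬(B.card = q ∧ (B ∩ K).card ≤ 1 ∧ S.card = q + 2 ∧ (∃ y ∈ S \ B, rkN M (insert y B) = q)) from
        fun h => by obtain ⟨-, -, h', -⟩ := h; omega),
      add_zero, zero_add]
  have hw_GJ : ∀ B S : Finset α, B.card = q → (B ∩ K).card = 1 → S.card = q + 1 → (S ∩ K).card = 1 → w B S = gJ := by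
    intro B S h1 h2 h3 h4
    simp only [w, if_neg (show ¬(B.card = q + 1 ∧ S.card = q + 2) by omega),
      if_neg (show ¬(B.card = q ∧ (B ∩ K).card = 2 ∧ S.card = q + 1) by omega),
      if_neg (show ¬(B.card = q ∧ (B ∩ K).card = 2 ∧ S.card = q + 2 ∧ (S ∩ K).card = 3) by omega),
      if_neg (show ¬(B.card = q ∧ (B ∩ K).card = 1 ∧ S.card = q + 1 ∧ (S ∩ K).card = 2) by omega),
      if_pos (And.intro h1 (And.intro h2 (And.intro h3 h4))),
      if_neg (show ¬(B.card = q ∧ (B ∩ K).card = 0 ∧ S.card = q + 1 ∧ (S ∩ K).card = 1) by omega),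
      if_neg (show ¬(B.card = q ∧ (B ∩ K).card = 0 ∧ S.card = q + 1 ∧ (S ∩ K).card = 0) by omega),
      if_neg (show ¬(B.card = q ∧ (B ∩ K).card ≤ 1 ∧ S.card = q + 2 ∧ (∃ y ∈ S \ B, rkN M (insert y B) = q)) from
        fun h => by obtain ⟨-, -, h', -⟩ := h; omega),
      add_zero, zero_add]
  have hw_ZJ : ∀ B S : Finset α, B.card = q → (B ∩ K).card = 0 → S.card = q + 1 → (S ∩ K).card = 1 →
      w B S = 2 / 3 := by
    intro B S h1 h2 h3 h4
    simp only [w, if_neg (show ¬(B.card = q + 1 ∧ S.card = q + 2) by omega),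
      if_neg (show ¬(B.card = q ∧ (B ∩ K).card = 2 ∧ S.card = q + 1) by omega),
      if_neg (show ¬(B.card = q ∧ (B ∩ K).card = 2 ∧ S.card = q + 2 ∧ (S ∩ K).card = 3) by omega),
      if_neg (show ¬(B.card = q ∧ (B ∩ K).card = 1 ∧ S.card = q + 1 ∧ (S ∩ K).card = 2) by omega),
      if_neg (show ¬(B.card = q ∧ (B ∩ K).card = 1 ∧ S.card = q + 1 ∧ (S ∩ K).card = 1) by omega),
      if_pos (And.intro h1 (And.intro h2 (And.intro h3 h4))),
      if_neg (show ¬(B.card = q ∧ (B ∩ K).card = 0 ∧ S.card = q + 1 ∧ (S ∩ K).card = 0) by omega),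
      if_neg (show ¬(B.card = q ∧ (B ∩ K).card ≤ 1 ∧ S.card = q + 2 ∧ (∃ y ∈ S \ B, rkN M (insert y B) = q)) from
        fun h => by obtain ⟨-, -, h', -⟩ := h; omega),
      add_zero, zero_add]
  have hw_ZF : ∀ B S : Finset α, B.card = q → (B ∩ K).card = 0 → S.card = q + 1 → (S ∩ K).card = 0 → w B S = 1 := by
    intro B S h1 h2 h3 h4
    simp only [w, if_neg (show ¬(B.card = q + 1 ∧ S.card = q + 2) by omega),
      if_neg (show ¬(B.card = q ∧ (B ∩ K).card = 2 ∧ S.card = q + 1) by omega),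
      if_neg (show ¬(B.card = q ∧ (B ∩ K).card = 2 ∧ S.card = q + 2 ∧ (S ∩ K).card = 3) by omega),
      if_neg (show ¬(B.card = q ∧ (B ∩ K).card = 1 ∧ S.card = q + 1 ∧ (S ∩ K).card = 2) by omega),
      if_neg (show ¬(B.card = q ∧ (B ∩ K).card = 1 ∧ S.card = q + 1 ∧ (S ∩ K).card = 1) by omega),
      if_neg (show ¬(B.card = q ∧ (B ∩ K).card = 0 ∧ S.card = q + 1 ∧ (S ∩ K).card = 1) by omega),
      if_pos (And.intro h1 (And.intro h2 (And.intro h3 h4))),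
      if_neg (show ¬(B.card = q ∧ (B ∩ K).card ≤ 1 ∧ S.card = q + 2 ∧ (∃ y ∈ S \ B, rkN M (insert y B) = q)) from
        fun h => by obtain ⟨-, -, h', -⟩ := h; omega),
      add_zero, zero_add]
  -- the σ-clause: the only term alive on a `(q+2)`-set for a `q`-set with `≤ 1` point of `K`
  have hw_small_eq : ∀ B S : Finset α, B.card = q → (B ∩ K).card ≤ 1 → S.card = q + 2 →
      w B S = if (∃ y ∈ S \ B, rkN M (insert y B) = q) then σ else 0 := by
    intro B S h1 h2 h3
    simp only [w, if_neg (show ¬(B.card = q + 1 ∧ S.card = q + 2) by omega),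
      if_neg (show ¬(B.card = q ∧ (B ∩ K).card = 2 ∧ S.card = q + 1) by omega),
      if_neg (show ¬(B.card = q ∧ (B ∩ K).card = 2 ∧ S.card = q + 2 ∧ (S ∩ K).card = 3) by omega),
      if_neg (show ¬(B.card = q ∧ (B ∩ K).card = 1 ∧ S.card = q + 1 ∧ (S ∩ K).card = 2) by omega),
      if_neg (show ¬(B.card = q ∧ (B ∩ K).card = 1 ∧ S.card = q + 1 ∧ (S ∩ K).card = 1) by omega),
      if_neg (show ¬(B.card = q ∧ (B ∩ K).card = 0 ∧ S.card = q + 1 ∧ (S ∩ K).card = 1) by omega),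
      if_neg (show ¬(B.card = q ∧ (B ∩ K).card = 0 ∧ S.card = q + 1 ∧ (S ∩ K).card = 0) by omega),
      zero_add]
    by_cases hex : ∃ y ∈ S \ B, rkN M (insert y B) = q
    · rw [if_pos ⟨h1, h2, h3, hex⟩, if_pos hex]
    · rw [if_neg (fun h => hex h.2.2.2), if_neg hex]
  have hw_q_small : ∀ B S : Finset α, B.card = q → (B ∩ K).card ≤ 1 → S.card = q + 2 →
      w B S ≤ if (∃ y ∈ S \ B, rkN M (insert y B) = q) then σ else 0 :=
    fun B S h1 h2 h3 => le_of_eq (hw_small_eq B S h1 h2 h3)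
  have hw_σ : ∀ B S : Finset α, B.card = q → (B ∩ K).card ≤ 1 → S.card = q + 2 →
      (∃ y ∈ S \ B, rkN M (insert y B) = q) → w B S = σ := by
    intro B S h1 h2 h3 hex
    rw [hw_small_eq B S h1 h2 h3, if_pos hex]
  have hw_big : ∀ B S : Finset α, q + 3 ≤ S.card → w B S = 0 := by
    intro B S h
    simp only [w, if_neg (show ¬(B.card = q + 1 ∧ S.card = q + 2) by omega),
      if_neg (show ¬(B.card = q ∧ (B ∩ K).card = 2 ∧ S.card = q + 1) by omega),
      if_neg (show ¬(B.card = q ∧ (B ∩ K).card = 2 ∧ S.card = q + 2 ∧ (S ∩ K).card = 3) by omega),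
      if_neg (show ¬(B.card = q ∧ (B ∩ K).card = 1 ∧ S.card = q + 1 ∧ (S ∩ K).card = 2) by omega),
      if_neg (show ¬(B.card = q ∧ (B ∩ K).card = 1 ∧ S.card = q + 1 ∧ (S ∩ K).card = 1) by omega),
      if_neg (show ¬(B.card = q ∧ (B ∩ K).card = 0 ∧ S.card = q + 1 ∧ (S ∩ K).card = 1) by omega),
      if_neg (show ¬(B.card = q ∧ (B ∩ K).card = 0 ∧ S.card = q + 1 ∧ (S ∩ K).card = 0) by omega),
      if_neg (show ¬(B.card = q ∧ (B ∩ K).card ≤ 1 ∧ S.card = q + 2 ∧ (∃ y ∈ S \ B, rkN M (insert y B) = q)) from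
        fun h' => by obtain ⟨-, -, h'', -⟩ := h'; omega),
      add_zero]
  have hq1 : (0 : ℚ) < (q : ℚ) + 1 := by positivity
  have hq : 1 ≤ q := by omega
  -- (Cap)
  have hcap : ∀ S ∈ Shadow.levelSet M (q + 1),
      ∑ B ∈ (Profile.Rq M q).filter (fun B => B ⊆ S), w B S / ((q : ℚ) + 1) ≤ 1 := by
    intro S hS
    rw [Profile.mem_levelSet] at hS
    obtain ⟨hSg, hSr⟩ := hS
    have hSq : rkN M S = q + 1 := rkN_eq_iff.mpr hSr
    rw [← Finset.sum_div, div_le_one hq1]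
    have hSc : q + 1 ≤ S.card := hSq ▸ rkN_le_card S
    rcases (by omega : S.card = q + 1 ∨ S.card = q + 2 ∨ q + 3 ≤ S.card) with h1 | h2 | h3
    · exact cap_succ hK3 hKrk w hw_nonneg sI gI gJ (2 / 3) 1 hw_2I hw_GI hw_GJ hw_ZJ hw_ZF (by linarith) hcapJ hcapI hq
        h1 hSq
    · by_cases hKS : K ⊆ S
      · exact cap_Q hsimple hthin hKg hK3 hKrk w sQ σ hsQ hw_a1 hw_2Q hw_q_small hcapQ hq h2 hSq hKS
      · exact cap_extra hsimple hthin hKg hK3 hKrk w σ hσ h2q hq4 hw_a1 hw_2Q0 hw_q_small hSg h2 hSq hKS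
    · exact cap_big w hw_big h3
  -- (Dem)
  have hf1 : 1 ≤ (gr M).card - q - 1 := by omega
  have hfcast : (((gr M).card - q - 2 : ℕ) : ℚ) = (((gr M).card - q - 1 : ℕ) : ℚ) - 1 := by
    have e : (gr M).card - q - 2 = (gr M).card - q - 1 - 1 := by omega
    rw [e, Nat.cast_sub hf1]
    push_cast
    ring
  have hdem : ∀ B ∈ Profile.Rq M q, Profile.price M q (q + 1) B ≤
      ∑ S ∈ (Shadow.levelSet M (q + 1)).filter (fun S => B ⊆ S), w B S / ((q : ℚ) + 1) := by
    intro B hB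
    rw [ThinRow.price_succ_eq]
    split_ifs with hd
    · rw [← Finset.sum_div]
      apply div_le_div_of_nonneg_right _ hq1.le
      rw [Profile.mem_Rq] at hB
      obtain ⟨hBg, hBr⟩ := hB
      have hBq : rkN M B = q := rkN_eq_iff.mpr hBr
      rcases card_eq_or_eq_of_rkN_eq hthin hBg hBq with hBc | hBc
      · -- independent `q`-sets, by `|B ∩ K|`
        have hm : (B ∩ K).card ≤ 3 := (Finset.card_le_card Finset.inter_subset_right).trans hK3.le
        have hm3 : (B ∩ K).card ≠ 3 := by
          intro h3
          have hKB : K ⊆ B := (OneCircuit.subset_iff_card_inter_eq hK3).mpr h3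
          have := OneCircuit.rkN_add_one_le_card_of_subset hK3 hKrk hKB
          omega
        rcases (by omega : (B ∩ K).card = 2 ∨ (B ∩ K).card ≤ 1) with h2 | h1
        · exact dem_twoK hKg hK3 hKrk hthin w hw_nonneg sI sQ hw_2I hw_2Q hdem2 hBg hBc hBq h2
        · -- the crude demand bounds
          have hc1 : (crk M B : ℚ) ≤ (((gr M).card - q - 1 : ℕ) : ℚ) + 1 := by
            have := OneCircuit.crk_add_card_le B hBg
            exact_mod_cast (by omega : crk M B ≤ (gr M).card - q - 1 + 1)
          by_cases hin : ∃ y ∈ gr M \ B, rkN M (insert y B) = q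
          · obtain ⟨y, hy, hyr⟩ := hin
            have hyg : y ∈ gr M := (Finset.mem_sdiff.mp hy).1
            have hyB : y ∉ B := (Finset.mem_sdiff.mp hy).2
            rcases (by omega : (B ∩ K).card = 1 ∨ (B ∩ K).card = 0) with h1' | h0
            · obtain ⟨j, hj1, hj2, hle⟩ := dem_small_inner hKg hK3 hthin w hw_nonneg gI gJ σ (m := 1) (by omega)
                hw_GI hw_GJ hw_σ hBg hBc hBq h1' hyg hyB hyr
              have hjcast : (((gr M).card - q - 1 - j : ℕ) : ℚ) = (((gr M).card - q - 1 : ℕ) : ℚ) - j := by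
                rw [Nat.cast_sub (by omega)]
              rw [hjcast] at hle
              rw [hfcast] at hdemG
              rcases (by omega : j = 1 ∨ j = 2) with rfl | rfl
              · push_cast at hle; linarith
              · push_cast at hle; linarith
            · obtain ⟨j, hj1, hj2, hle⟩ := dem_small_inner hKg hK3 hthin w hw_nonneg (2 / 3) 1 σ (m := 0) (by omega)
                hw_ZJ hw_ZF hw_σ hBg hBc hBq h0 hyg hyB hyr
              have hjcast : (((gr M).card - q - 1 - j : ℕ) : ℚ) = (((gr M).card - q - 1 : ℕ) : ℚ) - j := by
                rw [Nat.cast_sub (by omega)]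
              rw [hjcast] at hle
              have hc0 : (crk M B : ℚ) ≤ (((gr M).card - q - 1 : ℕ) : ℚ) := by
                have := OneCircuit.crk_add_card_add_one_le hK3 hKrk hKg hBg h0
                exact_mod_cast (by omega : crk M B ≤ (gr M).card - q - 1)
              rcases (by omega : j = 2 ∨ j = 3) with rfl | rfl
              · push_cast at hle; linarith
              · push_cast at hle; linarith
          · have hno : ∀ x ∈ gr M, x ∉ B → rkN M (insert x B) ≠ q :=
              fun x hx hxB h => hin ⟨x, Finset.mem_sdiff.mpr ⟨hx, hxB⟩, h⟩
            rcases (by omega : (B ∩ K).card = 1 ∨ (B ∩ K).card = 0) with h1' | h0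
            · have hs := dem_small hKg hK3 w hw_nonneg gI gJ (m := 1) (by omega) hw_GI hw_GJ hBg hBc hBq h1' hno
              have e : (3 - 1 : ℕ) = 2 := rfl
              rw [e, hfcast] at hs
              rw [hfcast] at hdemG
              push_cast at hs
              linarith
            · have hs := dem_small hKg hK3 w hw_nonneg (2 / 3) 1 (m := 0) (by omega) hw_ZJ hw_ZF hBg hBc hBq h0 hno
              simp only [Nat.sub_zero] at hs
              have hc0 : (crk M B : ℚ) ≤ (((gr M).card - q - 1 : ℕ) : ℚ) := by
                have := OneCircuit.crk_add_card_add_one_le hK3 hKrk hKg hBg h0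
                exact_mod_cast (by omega : crk M B ≤ (gr M).card - q - 1)
              have e3 : (((gr M).card - q - 3 : ℕ) : ℚ) = (((gr M).card - q - 1 : ℕ) : ℚ) - 2 := by
                have e : (gr M).card - q - 3 = (gr M).card - q - 1 - 2 := by omega
                rw [e, Nat.cast_sub (by omega)]
                push_cast
                ring
              rw [e3] at hs
              push_cast at hs
              linarith
      · exact dem_a hthin w hw_nonneg hw_a hBg hBc hBq
    · exact Finset.sum_nonneg (fun S _ => div_nonneg (hw_nonneg B S) hq1.le)
  exact ⟨profileIneq_of_cert q (q + 1) (fun B S => w B S / ((q : ℚ) + 1)) hcap hdem,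
    hallIneq_of_cert q (q + 1) (fun B S => w B S / ((q : ℚ) + 1)) (fun B S => div_nonneg (hw_nonneg B S) hq1.le)
      hcap hdem⟩

end ThinTriangle
end PercRepro
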